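import Summits.HodgeConjecture.HodgeConjecture.Theorems.SoloBlindDimensionChain
import HarnessLib

/-!
# The lower window of degrees and the sharp link `MiddleHodge (n - 2) → DimHodge n`

A KERNEL COROLLARY of theorems already in the tree, recorded at summit level; bookkeeping, no new
input and no novelty claimed. It sharpens the link `dimHodge_of_middleHodge : MiddleHodge n → DimHodge n`
of `SoloBlindDimensionChain` by two levels, using hard Lefschetz ON `X` ITSELF (the tree's
`nonempty_hardLefschetzNFold_holds`, Voisin I Thm. 6.25 / Rem. 6.27, with
`HardLefschetzNFold.mem_algebraicClasses_of_index`) together with the proved extreme degrees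
(`hodgeConjectureFor_codim_zero`, `lefschetzOneOne_rational_holds`, `mem_algebraicClasses_of_degree_top`,
`IsOfHodgeType.eq_zero_pp_of_lt`):

* **lower window** (`hodgeConjectureFor_of_lowerWindow`): for a smooth projective complex `n`-fold `X`,
  the Hodge conjecture for `X` in every degree follows from the algebraicity of its rational
  `(p, p)`-classes in the window `2 ≤ p`, `2p ≤ n` only (degrees `0`, `2`, `2n - 2`, `2n` and
  `2p > 2n` are theorems; degrees `n < 2p < 2n - 2` come from the window by `L^{2p-n}`);
* **sharp link** (`dimHodge_of_middleHodge_sub_two`): `MiddleHodge (n - 2) → DimHodge n` — a window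
  class of degree `2p` on `X` is a middle-degree class of the `2(n - p)`-fold `X × ℙ^{n-2p}`
  (`mem_algebraicClasses_of_middle_of_prod_projectiveSpace`, or `X` itself if `2p = n`), and
  `n - p ≤ n - 2`; for `n ≤ 3` the floor `dimHodge_of_le_three` applies. Equivalently
  `MiddleHodge m → DimHodge (m + 2)`: the Hodge conjecture for rational `(m, m)`-classes on
  `2m`-folds implies the Hodge conjecture, in every degree, for every variety of dimension `≤ m + 2`;
* **fourfolds** (`dimHodge_four_iff_middleHodge_two`): `DimHodge 4 ↔ MiddleHodge 2` — the Hodge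
  conjecture for all fourfolds in all degrees is exactly its `(2,2)` case; and
  `dimHodge_five_of_middleHodge_three`;
* **thresholds** (`middleThreshold_add_two_le_dimThreshold`): if the Hodge conjecture fails, the
  first bad middle index `M₁` and the first bad dimension `D₁` satisfy `M₁ + 2 ≤ D₁ ≤ 2 M₁`
  (was `M₁ ≤ D₁ ≤ 2 M₁`); in particular `M₁ = 2 ↔ D₁ = 4` and `M₁ = 3 → D₁ ∈ {5, 6}`.

## References

* [VoisinHodgeI2002] C. Voisin, Hodge Theory and Complex Algebraic Geometry I (CUP 2002), Thm. 6.25,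
  Rem. 6.27, §7.1.2, Thm. 11.30, §11.3.
* [VoisinHodgeII2003] C. Voisin, Hodge Theory and Complex Algebraic Geometry II (CUP 2003), §9.2.4
  Prop. 9.20, §10.2.3 proof of Prop. 10.26.
* [BrosnanFangNiePearlstein2009] P. Brosnan, H. Fang, Z. Nie, G. Pearlstein, Singularities of
  admissible normal functions, Invent. Math. 177 (2009), §6 Lemma 48.
* [KerrPearlstein2011] M. Kerr, G. Pearlstein, An exponential history of functions with logarithmic
  growth, MSRI Publ. 58 (2011), §3.1.
* [Arapura2006] D. Arapura, Motivation for Hodge cycles, Adv. Math. 207 (2006), §4 Lemma 4.2.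
* [Deligne2000] P. Deligne, The Hodge conjecture (Clay, 2000), §1.
-/

noncomputable section

open CategoryTheory CategoryTheory.Limits AlgebraicGeometry MonoidalCategory CartesianMonoidalCategory
open Literature.AlgebraicGeometry Literature.AlgebraicGeometry.Motives
open Literature.AlgebraicGeometry.HodgeTheory
open Literature.AlgebraicTopology.SingularHomology

namespace Summit.HodgeConjecture.HodgeConjecture.Theorems.SoloBlind

/-- **The lower window of degrees.** For `X` smooth projective of dimension `n` over `ℂ`: if every
rational class of Hodge type `(p, p)` in `H²ᵖ(X(ℂ); ℂ)` with `2 ≤ p` and `2p ≤ n` is algebraic, then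
`HodgeConjectureFor n X` (every degree). Degree `0` is `hodgeConjectureFor_codim_zero`, degree `2`
is Lefschetz `(1,1)` (`lefschetzOneOne_rational_holds`), degree `2n` (`n ≥ 1`) is
`mem_algebraicClasses_of_degree_top`, degrees `> 2n` carry no non-zero `(p,p)`-classes
(`IsOfHodgeType.eq_zero_pp_of_lt`), and a rational `(p,p)`-class with `n < 2p < 2n` is `L^{2p-n} c'`
for a rational `(n-p, n-p)`-class `c'` of the window or of degree `2`
(`HardLefschetzNFold.mem_algebraicClasses_of_index` on `nonempty_hardLefschetzNFold_holds`).
[cite: VoisinHodgeI2002, Thm. 6.25, Rem. 6.27, §7.1.2 and Thm. 11.30]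
[cite: VoisinHodgeII2003, §9.2.4 Prop. 9.20 and §10.2.3 proof of Prop. 10.26]
[cite: KerrPearlstein2011, §3.1] -/
theorem hodgeConjectureFor_of_lowerWindow {n : ℕ} {X : Motives.SchemeOver ℂ}
    (hX : Motives.IsSmoothProjective n X)
    (hwin : ∀ p : ℕ, 2 ≤ p → 2 * p ≤ n → ∀ c : complexBetti X (2 * p), IsRationalClass c →
      IsOfHodgeType n X (2 * p) p p c → c ∈ algebraicClasses X p) :
    HodgeConjectureFor n X := by
  refine ⟨nonempty_hodgeModel_holds hX, fun p c hc hpp ↦ ?_⟩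
  rcases Nat.lt_or_ge n p with hnp | hpn
  · -- `p > n`: no non-zero `(p,p)`-classes in degree `2p > 2n`
    rw [hpp.eq_zero_pp_of_lt hnp]
    exact Submodule.zero_mem _
  rcases p.eq_zero_or_pos with rfl | hp0
  · -- `p = 0`
    exact hodgeConjectureFor_codim_zero c
  rcases eq_or_lt_of_le hpn with rfl | hpn'
  · -- `p = n ≥ 1`: the class of a point
    exact mem_algebraicClasses_of_degree_top hX hp0 c
  -- `1 ≤ p < n`
  by_cases h2p : 2 * p ≤ n
  · rcases (show p = 1 ∨ 2 ≤ p by omega) with rfl | hp2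
    · exact lefschetzOneOne_rational_holds hX c hc hpp
    · exact hwin p hp2 h2p c hc hpp
  · -- `n < 2p < 2n`: hard Lefschetz from degree `2l`, `l = n - p`, `1 ≤ l`, `2l < n`
    obtain ⟨l, hl⟩ : ∃ l, p + l = n := ⟨n - p, by omega⟩
    obtain ⟨Λ⟩ := nonempty_hardLefschetzNFold_holds n X hX
    refine Λ.mem_algebraicClasses_of_index (l := l) (j := p - l) (p := p) (by omega) (by omega)
      (fun c' hc' hll ↦ ?_) c hc hpp
    rcases (show l = 1 ∨ 2 ≤ l by omega) with rfl | hl2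
    · exact lefschetzOneOne_rational_holds hX c' hc' hll
    · exact hwin l hl2 (by omega) c' hc' hll

/-- **The window in a fixed dimension is fed by one middle level each**: for `X` smooth projective
of dimension `n` and `2 ≤ p`, `2p ≤ n`, the rational `(p,p)`-classes of `X` are algebraic as soon as
`MiddleHodge (n - p)` holds (`2p < n`: `c` is cut out of a middle-degree class of the `2(n-p)`-fold
`X × ℙ^{n-2p}`, `mem_algebraicClasses_of_middle_of_prod_projectiveSpace`; `2p = n`: `c` is a middle
class of `X`). [cite: BrosnanFangNiePearlstein2009, §6 Lemma 48] [cite: VoisinHodgeI2002, §7.3.2 and §11.1.2] -/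
theorem mem_algebraicClasses_of_window_of_middleHodge {n : ℕ} {X : Motives.SchemeOver ℂ}
    (hX : Motives.IsSmoothProjective n X) {p : ℕ} (h2p : 2 * p ≤ n) (h : MiddleHodge (n - p))
    (c : complexBetti X (2 * p)) (hc : IsRationalClass c) (hpp : IsOfHodgeType n X (2 * p) p p c) :
    c ∈ algebraicClasses X p := by
  rcases eq_or_lt_of_le h2p with heq | hlt
  · -- `2p = n`: the middle degree of `X` itself
    subst heq
    have e : 2 * p - p = p := by omega
    rw [e] at h
    exact h hX c hc hpp
  · -- `2p < n`: product step at `ℙʳ`, `r = n - 2p ≥ 1`, middle degree of the `2(p + r)`-fold `X × ℙʳ`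
    obtain ⟨r, hr⟩ : ∃ r, 2 * p + r = n := ⟨n - 2 * p, by omega⟩
    refine mem_algebraicClasses_of_middle_of_prod_projectiveSpace hodgePQ_independent_of_hodgeModel_holds
      (fun _ _ ↦ nonempty_hodgeModel_holds) (fun _ _ hY ↦ cupPreservesHodgeType_holds' hY) hX
      (p := p) (r := r) hr (by omega) (fun c' hc' hc'pp ↦ ?_) c hc hpp
    have hP : Motives.IsSmoothProjective r (Motives.projectiveSpace r ℂ) :=
      Motives.isSmoothProjective_projectiveSpace_holds ℂ r
    have hV := Motives.IsSmoothProjective.tensor_holds hX hP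
    have e : n + r = 2 * (p + r) := by omega
    rw [e] at hV
    have e' : n - p = p + r := by omega
    rw [e'] at h
    exact h hV c' hc' hc'pp

/-- **The sharp link `MiddleHodge (n - 2) → DimHodge n`.** The Hodge conjecture for rational
`(n-2, n-2)`-classes on `(2n-4)`-folds implies the Hodge conjecture in every degree for every smooth
projective complex variety of dimension `n`: by the lower window (`hodgeConjectureFor_of_lowerWindow`)
only degrees `2p` with `2 ≤ p`, `2p ≤ n` are at stake, each fed by `MiddleHodge (n - p)`
(`mem_algebraicClasses_of_window_of_middleHodge`) and `n - p ≤ n - 2` (`middleHodge_of_le`); for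
`n ≤ 3` the hypothesis is not needed (`dimHodge_of_le_three`). Sharpens `dimHodge_of_middleHodge`.
[cite: BrosnanFangNiePearlstein2009, §6 Lemma 48] [cite: VoisinHodgeI2002, Thm. 6.25, Thm. 11.30 and §11.3]
[cite: VoisinHodgeII2003, §10.2.3 proof of Prop. 10.26] -/
theorem dimHodge_of_middleHodge_sub_two {n : ℕ} (h : MiddleHodge (n - 2)) : DimHodge n := by
  intro X hX
  rcases (show n ≤ 3 ∨ 4 ≤ n by omega) with hn | hn
  · exact dimHodge_of_le_three hn hX
  exact hodgeConjectureFor_of_lowerWindow hX fun p hp2 h2p c hc hpp ↦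
    mem_algebraicClasses_of_window_of_middleHodge hX h2p
      (middleHodge_of_le (show n - p ≤ n - 2 by omega) h) c hc hpp

/-- The same link read upwards: `MiddleHodge m → DimHodge (m + 2)` — the Hodge conjecture for
rational `(m, m)`-classes on `2m`-folds gives the Hodge conjecture, in every degree, for every smooth
projective complex variety of dimension `≤ m + 2` (`dimHodge_of_le` for the lower dimensions).
[cite: BrosnanFangNiePearlstein2009, §6 Lemma 48] [cite: VoisinHodgeI2002, Thm. 6.25 and Thm. 11.30] -/
theorem dimHodge_add_two_of_middleHodge {m : ℕ} (h : MiddleHodge m) : DimHodge (m + 2) :=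
  dimHodge_of_middleHodge_sub_two (by simpa using h)

/-- Pointwise form at a given variety: for `X` smooth projective of dimension `n ≤ m + 2`,
`MiddleHodge m` gives `HodgeConjectureFor n X`.
[cite: BrosnanFangNiePearlstein2009, §6 Lemma 48] [cite: VoisinHodgeI2002, Thm. 6.25 and Thm. 11.30] -/
theorem hodgeConjectureFor_of_middleHodge_of_le {m n : ℕ} {X : Motives.SchemeOver ℂ} (hn : n ≤ m + 2)
    (h : MiddleHodge m) (hX : Motives.IsSmoothProjective n X) : HodgeConjectureFor n X :=
  dimHodge_of_le hn (dimHodge_add_two_of_middleHodge h) hX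

/-- **Fourfolds**: `DimHodge 4 ↔ MiddleHodge 2` — the Hodge conjecture for all smooth projective
complex fourfolds in all degrees is exactly the Hodge conjecture for rational `(2,2)`-classes on
fourfolds (`dimHodge_add_two_of_middleHodge` at `m = 2`; `middleHodge_of_dimHodge_two_mul`).
[cite: VoisinHodgeI2002, Thm. 6.25, Thm. 11.30 and §11.3] [cite: Deligne2000, §1] -/
theorem dimHodge_four_iff_middleHodge_two : DimHodge 4 ↔ MiddleHodge 2 :=
  ⟨fun h ↦ middleHodge_of_dimHodge_two_mul (m := 2) h, fun h ↦ dimHodge_add_two_of_middleHodge h⟩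

/-- **Fivefolds**: the Hodge conjecture for rational `(3,3)`-classes on sixfolds implies the Hodge
conjecture in every degree for all varieties of dimension `≤ 5`. [cite: BrosnanFangNiePearlstein2009, §6 Lemma 48] -/
theorem dimHodge_five_of_middleHodge_three (h : MiddleHodge 3) : DimHodge 5 :=
  dimHodge_add_two_of_middleHodge h

/-- The first open case in both chains is the same statement: `¬ DimHodge 4 ↔ ¬ MiddleHodge 2`, i.e.
a counterexample among fourfolds exists iff a rational non-algebraic `(2,2)`-class on a fourfold exists.
[cite: VoisinHodgeI2002, §11.3] [cite: Deligne2000, §1] -/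
theorem not_dimHodge_four_iff_not_middleHodge_two : ¬ DimHodge 4 ↔ ¬ MiddleHodge 2 :=
  not_congr dimHodge_four_iff_middleHodge_two

/-! ### The sharpened threshold inequality -/

/-- **Thresholds, middle degree vs dimension, sharp form**: if `M₁` and `D₁` are the thresholds of
the `MiddleHodge` and `DimHodge` chains then `M₁ + 2 ≤ D₁ ≤ 2 M₁` (`dimHodge_add_two_of_middleHodge`
at `m = M₁ - 1`; `middleHodge_of_dimHodge_two_mul`). Replaces `M₁ ≤ D₁` of
`middleThreshold_le_dimThreshold_le`. [cite: BrosnanFangNiePearlstein2009, §6 Lemma 48]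
[cite: VoisinHodgeI2002, Thm. 6.25 and Thm. 11.30] -/
theorem middleThreshold_add_two_le_dimThreshold {M₁ D₁ : ℕ} (hM : ∀ m, MiddleHodge m ↔ m < M₁)
    (hD : ∀ n, DimHodge n ↔ n < D₁) : M₁ + 2 ≤ D₁ ∧ D₁ ≤ 2 * M₁ := by
  refine ⟨?_, (middleThreshold_le_dimThreshold_le hM hD).2⟩
  have hM1 : 1 ≤ M₁ := by
    by_contra h0
    exact absurd ((hM 0).1 (middleHodge_of_le_one (by omega))) (by omega)
  by_contra hlt
  have hmid : MiddleHodge (M₁ - 1) := (hM (M₁ - 1)).2 (by omega)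
  have hdim : DimHodge (M₁ - 1 + 2) := dimHodge_add_two_of_middleHodge hmid
  exact absurd ((hD (M₁ - 1 + 2)).1 hdim) (by omega)

/-- **`M₁ = 2 ↔ D₁ = 4`**: the first counterexample to the Hodge conjecture is a fourfold iff it is
a `(2,2)`-class on a fourfold (thresholds of the two chains; from `M₁ + 2 ≤ D₁ ≤ 2 M₁`).
[cite: VoisinHodgeI2002, §11.3] [cite: BrosnanFangNiePearlstein2009, §6 Lemma 48] -/
theorem middleThreshold_eq_two_iff_dimThreshold_eq_four {M₁ D₁ : ℕ}
    (hM : ∀ m, MiddleHodge m ↔ m < M₁) (hD : ∀ n, DimHodge n ↔ n < D₁) : M₁ = 2 ↔ D₁ = 4 := by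
  have h := middleThreshold_add_two_le_dimThreshold hM hD
  have hM2 : 2 ≤ M₁ := by
    by_contra hlt
    exact absurd ((hM 1).1 (middleHodge_of_le_one le_rfl)) (by omega)
  constructor <;> intro h' <;> omega

/-- **`M₁ = 3 → D₁ ∈ {5, 6}`**: if fourfold `(2,2)`-classes are algebraic but some rational
`(3,3)`-class on a sixfold is not, the first counterexample dimension is `5` or `6`.
[cite: BrosnanFangNiePearlstein2009, §6 Lemma 48] -/
theorem dimThreshold_of_middleThreshold_eq_three {M₁ D₁ : ℕ}
    (hM : ∀ m, MiddleHodge m ↔ m < M₁) (hD : ∀ n, DimHodge n ↔ n < D₁) (h3 : M₁ = 3) :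
    D₁ = 5 ∨ D₁ = 6 := by
  have h := middleThreshold_add_two_le_dimThreshold hM hD
  omega

/-- **The threshold triangle, sharpened.** If the Hodge conjecture fails, the thresholds `M₁ ≥ 2`,
`D₁ ≥ 4`, `N₁ ≥ 2` of the three chains satisfy `M₁ + 2 ≤ D₁ ≤ 2 M₁`, `M₁ ≤ N₁ ≤ 3 M₁`,
`N₁ ≤ 2 D₁`, `D₁ ≤ 2 N₁`. [cite: BrosnanFangNiePearlstein2009, §6 Lemma 48] [cite: Deligne2000, §1] -/
theorem exists_threshold_triangle_of_not_hodgeConjecture' (h : ¬ _root_.HodgeConjecture) :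
    ∃ M₁ D₁ N₁ : ℕ, (2 ≤ M₁ ∧ 4 ≤ D₁ ∧ 2 ≤ N₁) ∧
      (∀ m, MiddleHodge m ↔ m < M₁) ∧ (∀ n, DimHodge n ↔ n < D₁) ∧ (∀ N, SquareHodge N ↔ N < N₁) ∧
      (M₁ + 2 ≤ D₁ ∧ D₁ ≤ 2 * M₁) ∧ (M₁ ≤ N₁ ∧ N₁ ≤ 3 * M₁) ∧ (N₁ ≤ 2 * D₁ ∧ D₁ ≤ 2 * N₁) := by
  obtain ⟨M₁, D₁, N₁, hbd, hM, hD, hN, -, hMN, hND⟩ := exists_threshold_triangle_of_not_hodgeConjecture h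
  exact ⟨M₁, D₁, N₁, hbd, hM, hD, hN, middleThreshold_add_two_le_dimThreshold hM hD, hMN, hND⟩

end Summit.HodgeConjecture.HodgeConjecture.Theorems.SoloBlind

end
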